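import Literature.NumberTheory.Automorphic.UnramifiedEigencharactersSeparate
import Literature.NumberTheory.Automorphic.HeckeEigencharacterW0Invariance
import Literature.NumberTheory.Automorphic.SatakeTransformGLInjective
import Literature.NumberTheory.Automorphic.SymplecticSimilitudeCartanIwasawaUniqueness
import Mathlib.LinearAlgebra.Dimension.Free
import HarnessLib

/-!
# The unramified eigencharacters separate the Hecke algebra of ANY Iwasawa datum with injective Satake transform and free
# exponent lattice — `GL_n(F)`, `GSp_{2n}(K)` (every `n`), and `GSp_{2n}` at the places of a number field
# (Cartier §IV Thm. 4.1, Cor. 4.2)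

Topic `NumberTheory/Automorphic`; namespaces `Literature.NumberTheory.Automorphic[.IsIwasawaExponent | .SymplecticCartan]`
(lane `lit-hodgefound`, Track 2 foundations; seat `lit-hodgefound-p11`, generation 47, row g47-#12).  THEOREMS ONLY: no
definition, no named fact, no instance, no notation.  Sequel of `UnramifiedEigencharactersSeparate` (g47-#11: a Laurent
polynomial vanishing on `(ℂˣ)ᵐ` is zero; `U_N`, `Sp_{2n}`) and `HeckeEigencharacterW0Invariance` (g47-#7: `ev_χ(e_* f) = ev_{χ∘e}(f)`).

## The mathematics

Let `(P, K, a : G → Λ)` be an Iwasawa datum (`SatakeTransformIwasawa`), `w` a weight, `𝒮_w : ℋ(G, K; ℂ) → ℂ[Λ]` its Satake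
transform and `λ_{w,χ} = ev_χ ∘ 𝒮_w` (`χ ∈ Hom(Λ, ℂˣ)`) its eigencharacters.  **If `𝒮_w` is injective and `Λ ≅ ℤᵐ` is free of
finite rank, then `λ_{w,χ}(T) = 0` for all `χ` forces `T = 0`**: transporting `𝒮_w(T)` along `e : Λ ≅ ℤᵐ` gives a Laurent
polynomial whose value at `z ∈ (ℂˣ)ᵐ` is `λ_{w, z∘e}(T) = 0`, hence it vanishes (g47-#11), hence `𝒮_w(T) = 0`.  So **a Hecke
operator is determined by its unramified eigenvalues** — for `GL_n(F)` (every weight; `𝒮_w` injective, `SatakeTransformGLInjective`),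
for `GSp_{2n}(K)` (`Λ = ℤⁿ × ℤ`; `SymplecticSimilitudeCartanIwasawaUniqueness`), and for `GSp_{2n}(F_v)` at every finite place.

## What is formalised (theorems only)

* §1 (abstract) **`IsIwasawaExponent.eq_zero_of_forall_heckeEigencharacter_comp_eq_zero`** (given `e : Λ ≃+ ℤᵐ`),
  **`IsIwasawaExponent.eq_zero_of_forall_heckeEigencharacter_eq_zero`**, `IsIwasawaExponent.eq_iff_forall_heckeEigencharacter_eq`
  (`Λ` free of finite rank).
* §2 (`GL_n(F)`, every weight `w`) **`eq_zero_of_forall_heckeEigencharacter_gl_eq_zero`**, `eq_iff_forall_heckeEigencharacter_gl_eq`.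
* §3 (`GSp_{2n}(K)`, `q ∈ ℂˣ`) **`eq_zero_of_forall_similitudeHeckeEigencharacter_eq_zero`**,
  `eq_iff_forall_similitudeHeckeEigencharacter_eq`; (places) `eq_zero_of_forall_similitudeHeckeEigencharacterAdic_eq_zero`,
  `eq_iff_forall_similitudeHeckeEigencharacterAdic_eq`.

## References
* [CartierCorvallis1979] P. Cartier, *Representations of 𝔭-adic groups: a survey*, PSPM 33.1 (1979), §IV (4.2), Thm. 4.1, Cor. 4.2.
* [Alon1999] N. Alon, *Combinatorial Nullstellensatz*, Combin. Probab. Comput. 8 (1999), Lemma 2.1.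
-/

noncomputable section

open scoped Valued WithZero Matrix MatrixGroups
open Matrix MonoidAlgebra Representation NumberField IsDedekindDomain

/-! ## §1 Any Iwasawa datum with injective Satake transform and free exponent lattice -/

namespace Literature.NumberTheory.Automorphic.IsIwasawaExponent

open Literature.NumberTheory.Automorphic

variable {G : Type*} [Group G] {Λ : Type*} [AddCommGroup Λ] {P K : Subgroup G} {a : G → Λ}

/-- **`λ_{w, z∘e}(T) = 0` for all `z ∈ (ℂˣ)ᵐ` forces `T = 0`** when `𝒮_w` is injective (`e : Λ ≅ ℤᵐ`): the transport
`e_* 𝒮_w(T) ∈ ℂ[ℤᵐ]` vanishes on the torus. [cite: CartierCorvallis1979, §IV Thm. 4.1, Cor. 4.2] [cite: Alon1999, Lemma 2.1] -/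
theorem eq_zero_of_forall_heckeEigencharacter_comp_eq_zero (h : IsIwasawaExponent P K a) (w : Multiplicative Λ →* ℂ)
    (hinj : Function.Injective (h.satakeTransform w)) {m : ℕ} (e : Λ ≃+ (Fin m → ℤ)) {T : heckeAlgebra ℂ G K}
    (hT : ∀ z : Fin m → ℂˣ,
      h.heckeEigencharacter w ((laurentMonomialHom z).comp (AddMonoidHom.toMultiplicative e.toAddMonoidHom)) T = 0) :
    T = 0 := by
  refine (injective_iff_map_eq_zero _).1 hinj T ?_
  have h0 : AddMonoidAlgebra.domCongr ℂ ℂ e (h.satakeTransform w T) = 0 :=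
    eq_zero_of_forall_laurentEvalAt_eq_zero _ fun z => by
      change AddMonoidAlgebra.lift ℂ ℂ (Fin m → ℤ) (laurentMonomialHom z) (AddMonoidAlgebra.domCongr ℂ ℂ e (h.satakeTransform w T)) = 0
      rw [lift_domCongr, ← h.heckeEigencharacter_apply]
      exact hT z
  exact (map_eq_zero_iff _ (AddMonoidAlgebra.domCongr ℂ ℂ e).injective).1 h0

/-- **THE UNRAMIFIED EIGENCHARACTERS SEPARATE `ℋ(G, K; ℂ)`** for every Iwasawa datum with injective Satake transform and
exponent lattice `Λ` free of finite rank: `λ_{w,χ}(T) = 0` for all `χ ∈ Hom(Λ, ℂ)` forces `T = 0`.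
[cite: CartierCorvallis1979, §IV Thm. 4.1, Cor. 4.2] -/
theorem eq_zero_of_forall_heckeEigencharacter_eq_zero [Module.Free ℤ Λ] [Module.Finite ℤ Λ] (h : IsIwasawaExponent P K a)
    (w : Multiplicative Λ →* ℂ) (hinj : Function.Injective (h.satakeTransform w)) {T : heckeAlgebra ℂ G K}
    (hT : ∀ χ : Multiplicative Λ →* ℂ, h.heckeEigencharacter w χ T = 0) : T = 0 :=
  h.eq_zero_of_forall_heckeEigencharacter_comp_eq_zero w hinj (Module.finBasis ℤ Λ).equivFun.toAddEquiv fun _ => hT _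

/-- **A Hecke operator is determined by its unramified eigenvalues**: `S = T ⟺ λ_{w,χ}(S) = λ_{w,χ}(T)` for all `χ`
(`𝒮_w` injective, `Λ` free of finite rank). [cite: CartierCorvallis1979, §IV Thm. 4.1, Cor. 4.2] -/
theorem eq_iff_forall_heckeEigencharacter_eq [Module.Free ℤ Λ] [Module.Finite ℤ Λ] (h : IsIwasawaExponent P K a)
    (w : Multiplicative Λ →* ℂ) (hinj : Function.Injective (h.satakeTransform w)) (S T : heckeAlgebra ℂ G K) :
    S = T ↔ ∀ χ : Multiplicative Λ →* ℂ, h.heckeEigencharacter w χ S = h.heckeEigencharacter w χ T :=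
  ⟨fun hST _ => hST ▸ rfl, fun hST => sub_eq_zero.1
    (h.eq_zero_of_forall_heckeEigencharacter_eq_zero w hinj fun χ => by rw [map_sub, hST, sub_self])⟩

end Literature.NumberTheory.Automorphic.IsIwasawaExponent

/-! ## §2 `GL_n(F)` -/

namespace Literature.NumberTheory.Automorphic

open ValuativeRel Literature.NumberTheory.Automorphic.HermitianLattice

section GeneralLinear

variable {F : Type*} [Field F] [ValuativeRel F] {n : ℕ} [IsDiscreteValuationRing 𝒪[F]] {ϖ : F}

/-- **THE UNRAMIFIED EIGENCHARACTERS SEPARATE `ℋ(GL_n(F), GL_n(𝒪); ℂ)`** (every weight `w`): `λ_{w,χ_z}(T) = 0` for all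
`z ∈ (ℂˣ)ⁿ` forces `T = 0`. [cite: CartierCorvallis1979, §IV Thm. 4.1, Cor. 4.2] -/
theorem eq_zero_of_forall_heckeEigencharacter_gl_eq_zero (hϖ : IsUniformizingElement ϖ) (w : Multiplicative (Fin n → ℤ) →* ℂ)
    {T : heckeAlgebra ℂ (GL (Fin n) F) (glInt n F)}
    (hT : ∀ z : Fin n → ℂˣ, (isIwasawaExponent_gl hϖ).heckeEigencharacter w (laurentMonomialHom z) T = 0) : T = 0 :=
  (isIwasawaExponent_gl hϖ).eq_zero_of_forall_heckeEigencharacter_comp_eq_zero w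
    (isIwasawaExponent_gl_satakeTransform_injective hϖ w) (AddEquiv.refl _) fun z => by
      rw [show (laurentMonomialHom z).comp (AddMonoidHom.toMultiplicative (AddEquiv.refl (Fin n → ℤ)).toAddMonoidHom) =
          laurentMonomialHom z from MonoidHom.ext fun _ => rfl]
      exact hT z

/-- **A Hecke operator on `GL_n(F)` is determined by its unramified eigenvalues** (every weight `w`).
[cite: CartierCorvallis1979, §IV Thm. 4.1, Cor. 4.2] -/
theorem eq_iff_forall_heckeEigencharacter_gl_eq (hϖ : IsUniformizingElement ϖ) (w : Multiplicative (Fin n → ℤ) →* ℂ)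
    (S T : heckeAlgebra ℂ (GL (Fin n) F) (glInt n F)) :
    S = T ↔ ∀ z : Fin n → ℂˣ, (isIwasawaExponent_gl hϖ).heckeEigencharacter w (laurentMonomialHom z) S =
      (isIwasawaExponent_gl hϖ).heckeEigencharacter w (laurentMonomialHom z) T :=
  ⟨fun hST _ => hST ▸ rfl, fun hST => sub_eq_zero.1
    (eq_zero_of_forall_heckeEigencharacter_gl_eq_zero hϖ w fun z => by rw [map_sub, hST, sub_self])⟩

end GeneralLinear

end Literature.NumberTheory.Automorphic

/-! ## §3 `GSp_{2n}(K)` and `GSp_{2n}(F_v)` -/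

namespace Literature.NumberTheory.Automorphic.SymplecticCartan

open Literature.NumberTheory.Automorphic.CartanUnique Literature.NumberTheory.Automorphic

section Local

variable {K : Type*} [Field K] [Valued K ℤᵐ⁰] {ϖ : K} {n : ℕ} [NeZero n] (hϖ : Valued.v ϖ = WithZero.exp (-1 : ℤ))
include hϖ

/-- **THE UNRAMIFIED EIGENCHARACTERS SEPARATE `ℋ(GSp_{2n}(K), GSp_{2n}(𝒪); ℂ)`** (`q ∈ ℂˣ`): `λ_{q,χ}(T) = 0` for all
characters `χ` of `ℤⁿ × ℤ` forces `T = 0`. [cite: CartierCorvallis1979, §IV Thm. 4.1, Cor. 4.2] -/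
theorem eq_zero_of_forall_similitudeHeckeEigencharacter_eq_zero (q : ℂˣ)
    {T : heckeAlgebra ℂ (symplecticSimilitudeGroup (Fin n) K) (symplecticSimilitudeInt (Fin n) K)}
    (hT : ∀ χ : Multiplicative ((Fin n → ℤ) × ℤ) →* ℂ, similitudeHeckeEigencharacter hϖ q χ T = 0) : T = 0 :=
  (isIwasawaExponent_similitude hϖ).eq_zero_of_forall_heckeEigencharacter_eq_zero (similitudeSatakeWeight q)
    (similitudeSatakeTransform_injective_of_commRing hϖ q) hT

/-- **A Hecke operator on `GSp_{2n}(K)` is determined by its unramified eigenvalues.** [cite: CartierCorvallis1979, §IV Thm. 4.1, Cor. 4.2] -/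
theorem eq_iff_forall_similitudeHeckeEigencharacter_eq (q : ℂˣ)
    (S T : heckeAlgebra ℂ (symplecticSimilitudeGroup (Fin n) K) (symplecticSimilitudeInt (Fin n) K)) :
    S = T ↔ ∀ χ : Multiplicative ((Fin n → ℤ) × ℤ) →* ℂ,
      similitudeHeckeEigencharacter hϖ q χ S = similitudeHeckeEigencharacter hϖ q χ T :=
  (isIwasawaExponent_similitude hϖ).eq_iff_forall_heckeEigencharacter_eq (similitudeSatakeWeight q)
    (similitudeSatakeTransform_injective_of_commRing hϖ q) S T

end Local

section NumberField

variable (F : Type*) [Field F] [NumberField F] (v : HeightOneSpectrum (𝓞 F)) {n : ℕ} [NeZero n]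

/-- **At every finite place `v`: `λ_{v,χ}(T) = 0` for all `χ` forces `T = 0` in `ℋ(GSp_{2n}(F_v), GSp_{2n}(𝒪_v); ℂ)`.**
[cite: CartierCorvallis1979, §IV Thm. 4.1, Cor. 4.2] -/
theorem eq_zero_of_forall_similitudeHeckeEigencharacterAdic_eq_zero
    {T : heckeAlgebra ℂ (symplecticSimilitudeGroup (Fin n) (v.adicCompletion F)) (symplecticSimilitudeInt (Fin n) (v.adicCompletion F))}
    (hT : ∀ χ : Multiplicative ((Fin n → ℤ) × ℤ) →* ℂ, similitudeHeckeEigencharacterAdic F v χ T = 0) : T = 0 :=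
  eq_zero_of_forall_similitudeHeckeEigencharacter_eq_zero (v_adicUniformizer F v) (residueNormUnit F v) hT

/-- **A Hecke operator on `GSp_{2n}(F_v)` is determined by its unramified eigenvalues**, at every finite place.
[cite: CartierCorvallis1979, §IV Thm. 4.1, Cor. 4.2] -/
theorem eq_iff_forall_similitudeHeckeEigencharacterAdic_eq
    (S T : heckeAlgebra ℂ (symplecticSimilitudeGroup (Fin n) (v.adicCompletion F)) (symplecticSimilitudeInt (Fin n) (v.adicCompletion F))) :
    S = T ↔ ∀ χ : Multiplicative ((Fin n → ℤ) × ℤ) →* ℂ,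
      similitudeHeckeEigencharacterAdic F v χ S = similitudeHeckeEigencharacterAdic F v χ T :=
  eq_iff_forall_similitudeHeckeEigencharacter_eq (v_adicUniformizer F v) (residueNormUnit F v) S T

end NumberField

end Literature.NumberTheory.Automorphic.SymplecticCartan
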